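import Mathlib
import Summits.Langlands.Langlands.Theses.PicardMuOrdinary
import Literature.NumberTheory.GaloisRepresentations.GaloisRep
import Literature.NumberTheory.GaloisRepresentations.OrdinaryRegular
import Literature.NumberTheory.GaloisRepresentations.LocalClassFieldTheory
import Literature.NumberTheory.GaloisRepresentations.LocalClassFieldTheoryDischargeProofs
import Literature.NumberTheory.Automorphic.ReciprocityGLnProofs
import Literature.NumberTheory.Automorphic.AsaiSign

/-!
# Line `split-ramified-prime-sqrt6` — the RE-ROUTE KIT: the ordinary twisted-polarized restate carried to
# ROUTE level, with the ALIGNED guard and a kernel-checked deciding theorem `closes_ord`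
# (continuation lead prover-line-stmt-Langlands-13758-c2-0, 2026-08-16)

Companion of `Lines/split_ramified_prime_sqrt6.lean` (reshape r7) and of lead c1's
`Lines/split_ramified_prime_sqrt6_restated_ord.lean` (which typed the 13758 side: `OrdPolarizedTower`,
`OrdTwistedPolarizedLimitHypothesis`, `IrregularClassicalityOrd`, and the certificate
`irregularClassicalityOrd_of`).  What c1 left in prose is typed here, so that the tenure / route-repair
planner's re-route (obligation-graph §2.5: "re-route (restate the parent), replace the crux, declare a
conditional bridge, or retire the route") is a mechanical `ledger route edit --closes-file` step:

1. `MuOrdinaryGaloisGuard art ρ` — the ALIGNED Galois-side μ-ordinarity guard of reshape r7 (NOT drefute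
   g3's `∃ A B` guard, which the split-basic CM anchor `f₆₇` passes: see the r7 note in
   `Lines/split_ramified_prime_sqrt6.lean`), and `MuOrdinaryClass art f` — its `f`-level form: SOME framed
   `ρ` carrying Stub 2's trace identity for the twisted Picard traces `e(a_𝔭(f)·ϖ_𝔭)` off a finite
   `S₀ ⊇ {v ∣ 3}` (which pins `ρ ≅ ρ'_C` on paper: Chebotarev + Brauer–Nesbitt, `ρ̄'_C` absolutely
   irreducible) passes the aligned guard.  No new definition item is needed: everything is stated with
   accepted tree predicates (`FramedGaloisRep.IsOrdinaryOfLabelledWeightAt`, `LocalArtinData`,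
   `IsArithFrobAt`, `picardTrace`).
2. The three restated items, as `def … : Prop` in the route's own binder conventions:
   `MuOrdinaryFamilyRTOrd` (13757ᵒʳᵈ: generic `f` IN the aligned μ-ordinary class, residually automorphic
   as now ⇒ the ORDINARY twisted-polarized tower with avatars), `IrregularClassicalityOrd` (13758ᵒʳᵈ, c1's
   text verbatim), `BasicLocusAutomorphy` (the conceded third branch: generic `f` OUTSIDE the class ⇒ the
   target's conclusion; crux-sized, no mechanism in print, contains BBW type (a) and the split-basic CM
   points, the latter automorphic on paper by cubic automorphic induction).
3. `closes_ord : ResidualAutomorphyOdd → ResidualAutomorphyEven → MuOrdinaryFamilyRTOrd →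
   IrregularClassicalityOrd → BasicLocusAutomorphy → SectorComplement → Langlands` — the deciding theorem
   of the re-routed thesis, kernel-checked against the CURRENT route file's `ResidualAutomorphyOdd/Even`,
   `SectorComplement`, `PicardAutomorphy`; the local Artin data are supplied by the tree's discharged local
   class field theory (`nonempty_localArtinData_at`), so `art` is a `∀`-binder of every restated item and
   no item depends on a choice.
4. No-refutation-room lemmas: `IrregularClassicalityOrd` and `BasicLocusAutomorphy` are implied by the
   target `PicardAutomorphy` (`…_of_picardAutomorphy`); `MuOrdinaryFamilyRTOrd` is NOT (it asserts the
   existence of new automorphic data — the honest content of 13757, refutable in principle, e.g. by the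
   `±1 ∈ Sat` shape at inert primes of Disproof §13, never in-tree).

All statements elaborate; the only proofs are bookkeeping.  Nothing here is proposed to the gate: the
file is EVIDENCE for the planner (provers do not edit routes, D-0014/D-0016).
-/

open scoped BigOperators Topology Manifold Classical MeasureTheory ProbabilityTheory Matrix InnerProductSpace ComplexConjugate ContinuousMap
open Literature.NumberTheory.GaloisRepresentations Literature.NumberTheory.Automorphic
open IsDedekindDomain NumberField Polynomial

set_option linter.dupNamespace false

noncomputable section

namespace Summit.Langlands.Langlands.Cruxes.IrregularClassicality.SplitRamifiedPrimeSqrt6.RouteOrd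

/-! ## Vocabulary (verbatim from reshape r7 and lead c1's restate) -/

/-- A choice of local Artin datum at every finite place of `K = ℚ(ω)`. -/
abbrev ArtinData : Type :=
  ∀ v : HeightOneSpectrum (𝓞 (CyclotomicField 3 ℚ)), LocalArtinData (v.adicCompletion (CyclotomicField 3 ℚ))

/-- Local Artin data exist (the tree's discharged local class field theory). [folklore] -/
theorem nonempty_artinData : Nonempty ArtinData :=
  ⟨fun v => Classical.choice (nonempty_localArtinData_at (v.adicCompletion (CyclotomicField 3 ℚ)))⟩

/-- Aligned labelled weights (reshape r7, verbatim): the ordinary Hodge–Tate weights `i ↦ wt τ i.rev + i`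
are weakly increasing along the rows at every label — the closure of `LabelledWeight.IsDominant`. -/
def IsAlignedWeight {v : HeightOneSpectrum (𝓞 (CyclotomicField 3 ℚ))}
    (wt : LabelledWeight (v.adicCompletion (CyclotomicField 3 ℚ)) (PadicAlgCl 3) 3) : Prop :=
  ∀ τ : HodgeTateLabel (v.adicCompletion (CyclotomicField 3 ℚ)) (PadicAlgCl 3),
    Monotone fun i : Fin 3 => wt τ i.rev + (i : ℤ)

/-- Dominant weights are aligned. [folklore] -/
theorem isAlignedWeight_of_isDominant {v : HeightOneSpectrum (𝓞 (CyclotomicField 3 ℚ))}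
    {wt : LabelledWeight (v.adicCompletion (CyclotomicField 3 ℚ)) (PadicAlgCl 3) 3}
    (h : wt.IsDominant) : IsAlignedWeight wt :=
  fun τ => (h.strictMono τ).monotone

/-- The ALIGNED Galois-side μ-ordinarity guard (reshape r7, verbatim). -/
def MuOrdinaryGaloisGuard (art : ArtinData)
    (ρ : FramedGaloisRep (CyclotomicField 3 ℚ) (PadicAlgCl 3) 3) : Prop :=
  ∃ v : HeightOneSpectrum (𝓞 (CyclotomicField 3 ℚ)), ((3 : ℕ) : 𝓞 (CyclotomicField 3 ℚ)) ∈ v.asIdeal ∧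
    ∃ wt : LabelledWeight (v.adicCompletion (CyclotomicField 3 ℚ)) (PadicAlgCl 3) 3,
      IsAlignedWeight wt ∧ ρ.IsOrdinaryOfLabelledWeightAt v (art v) wt

/-- **Twisted Picard witness** (the output shape of the landed Stub 2 `stub_twistedPicardGaloisInput`):
`S₀` contains the places above `3`; off `S₀`, `ϖ_𝔭` is the primary generator of `𝔭` and `ρ` is unramified
with geometric-Frobenius trace `ι⁻¹ e(a_𝔭(f)·ϖ_𝔭)`.  On paper this pins `ρ` to `ρ'_C = ρ_C ⊗ ψ` read
through `(ι, e)` (Chebotarev + Brauer–Nesbitt; `ρ̄'_C` absolutely irreducible for generic `f`). -/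
def TwistedPicardWitness (f : ℤ[X]) (ι : PadicAlgCl 3 ≃+* ℂ) (e : CyclotomicField 3 ℚ →+* ℂ)
    (S₀ : Finset (HeightOneSpectrum (𝓞 (CyclotomicField 3 ℚ))))
    (ϖ : HeightOneSpectrum (𝓞 (CyclotomicField 3 ℚ)) → 𝓞 (CyclotomicField 3 ℚ))
    (ρ : FramedGaloisRep (CyclotomicField 3 ℚ) (PadicAlgCl 3) 3) : Prop :=
  (∀ v : HeightOneSpectrum (𝓞 (CyclotomicField 3 ℚ)),
    ((3 : ℕ) : 𝓞 (CyclotomicField 3 ℚ)) ∈ v.asIdeal → v ∈ S₀) ∧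
  ∀ 𝔭 ∉ S₀,
    (𝔭.asIdeal = Ideal.span {ϖ 𝔭} ∧ ϖ 𝔭 - 1 ∈ Ideal.span {(3 : 𝓞 (CyclotomicField 3 ℚ))}) ∧
    ρ.IsUnramifiedAt 𝔭 ∧
    ∀ 𝔓 ∈ 𝔭.primesAbove, ∀ τ : Field.absoluteGaloisGroup (CyclotomicField 3 ℚ),
      IsArithFrobAt (𝓞 (CyclotomicField 3 ℚ)) τ 𝔓 →
        FramedRep.trace ρ τ⁻¹ = ι.symm (e (↑(picardTrace f 𝔭 * ϖ 𝔭)))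

/-- **The aligned μ-ordinary class at `f`-level** (the route's case split): some twisted Picard witness
`ρ` for `f` passes the aligned guard relative to `art`.  On paper: `J(C_f)` of BBW stable type (b)–(e)
(μ-ordinary or potentially multiplicative at `3`); excludes the split-basic CM points (anti-aligned flags,
r7 note) and, expectedly, the supersingular type (a) (no unit-root line). -/
def MuOrdinaryClass (art : ArtinData) (f : ℤ[X]) : Prop :=
  ∃ (ι : PadicAlgCl 3 ≃+* ℂ) (e : CyclotomicField 3 ℚ →+* ℂ)
    (S₀ : Finset (HeightOneSpectrum (𝓞 (CyclotomicField 3 ℚ))))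
    (ϖ : HeightOneSpectrum (𝓞 (CyclotomicField 3 ℚ)) → 𝓞 (CyclotomicField 3 ℚ))
    (ρ : FramedGaloisRep (CyclotomicField 3 ℚ) (PadicAlgCl 3) 3),
    TwistedPicardWitness f ι e S₀ ϖ ρ ∧ MuOrdinaryGaloisGuard art ρ

/-- The residual-automorphy hypothesis of 13757 (VERBATIM the parenthesised hypothesis of
`MuOrdinaryFamilyRT` = the conclusion of `ResidualAutomorphyOdd` / `ResidualAutomorphyEven`). -/
def ResidualHyp (f : ℤ[X]) (hcpt : isCompact_glFiniteIntegralLevel 3 (CyclotomicField 3 ℚ)) : Prop :=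
  ∃ (P : Literature.NumberTheory.Automorphic.CuspidalAutomorphicRepData 3 (CyclotomicField 3 ℚ) hcpt) (𝔐 : Ideal (integralClosure ℤ ℂ)), P.1.IsRegularAlgebraic ∧ 𝔐.IsMaximal ∧ (3 : (integralClosure ℤ ℂ)) ∈ 𝔐 ∧ ∀ᶠ 𝔭 : IsDedekindDomain.HeightOneSpectrum (NumberField.RingOfIntegers (CyclotomicField 3 ℚ)) in Filter.cofinite, ∃ (α : Multiset ℂ) (Q : Polynomial (integralClosure ℤ ℂ)), P.1.HasSatakeParamAt 𝔭 α ∧ Q.map (algebraMap (integralClosure ℤ ℂ) ℂ) = (α.map (fun a => Polynomial.X - Polynomial.C ((𝔭.residueCard : ℂ) * a))).prod ∧ Q.map (Ideal.Quotient.mk 𝔐) = (if (f.map ((Ideal.Quotient.mk 𝔭.asIdeal).comp (algebraMap ℤ (NumberField.RingOfIntegers (CyclotomicField 3 ℚ))))).roots.toFinset.card = 4 then (Polynomial.X - 1) ^ 3 else if (f.map ((Ideal.Quotient.mk 𝔭.asIdeal).comp (algebraMap ℤ (NumberField.RingOfIntegers (CyclotomicField 3 ℚ))))).roots.toFinset.card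 = 2 then (Polynomial.X - 1) ^ 2 * (Polynomial.X + 1) else if (f.map ((Ideal.Quotient.mk 𝔭.asIdeal).comp (algebraMap ℤ (NumberField.RingOfIntegers (CyclotomicField 3 ℚ))))).roots.toFinset.card = 1 then Polynomial.X ^ 3 - 1 else if (∃ y : ((NumberField.RingOfIntegers (CyclotomicField 3 ℚ)) ⧸ 𝔭.asIdeal), y ^ 2 = (f.map ((Ideal.Quotient.mk 𝔭.asIdeal).comp (algebraMap ℤ (NumberField.RingOfIntegers (CyclotomicField 3 ℚ))))).discr) then (Polynomial.X - 1) * (Polynomial.X + 1) ^ 2 else Polynomial.X ^ 3 + Polynomial.X ^ 2 + Polynomial.X + 1 : Polynomial ℤ).map (Int.castRingHom ((integralClosure ℤ ℂ) ⧸ 𝔐))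

/-- The conclusion of the target at `f`, `hcpt` (VERBATIM the conclusion of `PicardAutomorphy` and of
`IrregularClassicality`). -/
def AutomorphyConclusion (f : ℤ[X]) (hcpt : isCompact_glFiniteIntegralLevel 3 (CyclotomicField 3 ℚ)) :
    Prop :=
  ∃ (e : CyclotomicField 3 ℚ →+* ℂ) (π : CuspidalAutomorphicRepData 3 (CyclotomicField 3 ℚ) hcpt),
    π.1.IsLAlgebraic ∧
    ∀ᶠ 𝔭 : HeightOneSpectrum (𝓞 (CyclotomicField 3 ℚ)) in Filter.cofinite,
      ∃ α : Multiset ℂ, π.1.HasSatakeParamAt 𝔭 α ∧ α.sum = e (picardTrace f 𝔭)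

/-- A `K`-side ORDINARY twisted-polarized tower (lead c1, VERBATIM). -/
def OrdPolarizedTower (art : ArtinData) (hcpt : isCompact_glFiniteIntegralLevel 3 (CyclotomicField 3 ℚ))
    (ι : PadicAlgCl 3 ≃+* ℂ) (c₀ : CyclotomicField 3 ℚ ≃ₐ[ℚ] CyclotomicField 3 ℚ)
    (S : Finset (HeightOneSpectrum (𝓞 (CyclotomicField 3 ℚ))))
    (a : HeightOneSpectrum (𝓞 (CyclotomicField 3 ℚ)) → ℂ) : Prop :=
  ∀ k : ℕ, ∃ (P : CuspidalAutomorphicRepData 3 (CyclotomicField 3 ℚ) hcpt)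
    (r : FramedGaloisRep (CyclotomicField 3 ℚ) (PadicAlgCl 3) 3),
    P.1.IsRegularAlgebraic ∧ P.1.IsConjSelfDualAE c₀ ∧
    (∀ 𝔭 ∉ S, P.1.IsUnramifiedAt 𝔭 ∧ IsGaloisCompatibleAt P.1 ι r 𝔭 ∧
      ∃ (α : Multiset ℂ) (t : integralClosure ℤ ℂ), P.1.HasSatakeParamAt 𝔭 α ∧
        (t : ℂ) = (𝔭.residueCard : ℂ) * α.sum - a 𝔭 ∧ ‖ι.symm (t : ℂ)‖ ≤ ((3 : ℝ)⁻¹) ^ k) ∧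
    ∀ v : HeightOneSpectrum (𝓞 (CyclotomicField 3 ℚ)),
      ((3 : ℕ) : 𝓞 (CyclotomicField 3 ℚ)) ∈ v.asIdeal →
      ∃ wt : LabelledWeight (v.adicCompletion (CyclotomicField 3 ℚ)) (PadicAlgCl 3) 3,
        wt.IsDominant ∧ r.IsOrdinaryOfLabelledWeightAt v (art v) wt

/-- The ORDINARY twisted-polarized limit hypothesis (lead c1, VERBATIM): the 13757 → 13758 interface. -/
def OrdTwistedPolarizedLimitHypothesis (art : ArtinData) (f : ℤ[X])
    (hcpt : isCompact_glFiniteIntegralLevel 3 (CyclotomicField 3 ℚ)) : Prop :=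
  ∃ (e : CyclotomicField 3 ℚ →+* ℂ) (ι : PadicAlgCl 3 ≃+* ℂ)
    (S : Finset (HeightOneSpectrum (𝓞 (CyclotomicField 3 ℚ))))
    (c₀ : CyclotomicField 3 ℚ ≃ₐ[ℚ] CyclotomicField 3 ℚ)
    (ϖ : HeightOneSpectrum (𝓞 (CyclotomicField 3 ℚ)) → 𝓞 (CyclotomicField 3 ℚ)),
    c₀ ≠ 1 ∧
    (∀ 𝔭 ∉ S, 𝔭.asIdeal = Ideal.span {ϖ 𝔭} ∧ ϖ 𝔭 - 1 ∈ Ideal.span {(3 : 𝓞 (CyclotomicField 3 ℚ))}) ∧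
    OrdPolarizedTower art hcpt ι c₀ S (fun 𝔭 => e (↑(picardTrace f 𝔭 * ϖ 𝔭)))

/-! ## The three restated items -/

/-- **13757ᵒʳᵈ `MuOrdinaryFamilyRTOrd`** (proposed text).  For every choice of local Artin data and every
generic `f` in the ALIGNED μ-ordinary class: residual automorphy in regular weight (as now) ⇒ `ρ_C ⊗ ψ` is
an ORDINARY twisted-polarized `3`-adic limit of regular algebraic, exactly conjugate-self-dual cuspidal
automorphic representations with Galois avatars ordinary of dominant weight at `λ`.  The guard is the
hypothesis that keeps the statement honest: without it (type (a), split-basic CM) no ordinary tower is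
produced by any μ-ordinary engine; with drefute g3's unaligned guard `f₆₇` would be wrongly included. -/
def MuOrdinaryFamilyRTOrd : Prop :=
  ∀ (art : ArtinData) (f : ℤ[X]) (hcpt : isCompact_glFiniteIntegralLevel 3 (CyclotomicField 3 ℚ)),
    f.natDegree = 4 → (f.map (Int.castRingHom ℚ)).Separable →
    12 ∣ Nat.card (f.map (Int.castRingHom ℚ)).Gal →
    MuOrdinaryClass art f → ResidualHyp f hcpt → OrdTwistedPolarizedLimitHypothesis art f hcpt

/-- **13758ᵒʳᵈ `IrregularClassicalityOrd`** (lead c1's text, VERBATIM): an ordinary twisted-polarized limit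
⇒ automorphy of `C`.  Closed by c1's certificate `irregularClassicalityOrd_of` modulo the Picard named fact,
the Arthur–Clozel / HLTT quadruple and the heart `TwoWallOrdinaryClassicalityOrdStmt` (the open theorem). -/
def IrregularClassicalityOrd : Prop :=
  ∀ (art : ArtinData) (f : ℤ[X]) (hcpt : isCompact_glFiniteIntegralLevel 3 (CyclotomicField 3 ℚ)),
    f.natDegree = 4 → (f.map (Int.castRingHom ℚ)).Separable →
    12 ∣ Nat.card (f.map (Int.castRingHom ℚ)).Gal →
    OrdTwistedPolarizedLimitHypothesis art f hcpt → AutomorphyConclusion f hcpt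

/-- **Third branch `BasicLocusAutomorphy`** (proposed text; the conceded λ-basic class = reshape r7's
`stub_basicRemainder` without the typed tower): for every choice of local Artin data, a generic `f`
OUTSIDE the aligned μ-ordinary class, residually automorphic in regular weight (free: the two residual
branches hold for every generic `f`), is automorphic.  Crux-sized; TRUE under reciprocity; no mechanism in
print (type (a): no ordinary / finite-slope structure at the ramified rank-one prime; the split-basic CM
corner: cubic automorphic induction, Disproof item 20 (a)).  Refuters/graders: a weakening of the target. -/
def BasicLocusAutomorphy : Prop :=
  ∀ (art : ArtinData) (f : ℤ[X]) (hcpt : isCompact_glFiniteIntegralLevel 3 (CyclotomicField 3 ℚ)),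
    f.natDegree = 4 → (f.map (Int.castRingHom ℚ)).Separable →
    12 ∣ Nat.card (f.map (Int.castRingHom ℚ)).Gal →
    ¬ MuOrdinaryClass art f → ResidualHyp f hcpt → AutomorphyConclusion f hcpt

/-! ## The deciding theorem of the re-routed thesis -/

/-- The residual hypothesis from the two residual branches of the CURRENT route (their conclusions are
`ResidualHyp f hcpt` verbatim). [folklore] -/
theorem residualHyp_of_branches
    (hOdd : Summit.Langlands.Langlands.Theses.PicardMuOrdinary.ResidualAutomorphyOdd)
    (hEven : Summit.Langlands.Langlands.Theses.PicardMuOrdinary.ResidualAutomorphyEven)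
    (f : ℤ[X]) (hcpt : isCompact_glFiniteIntegralLevel 3 (CyclotomicField 3 ℚ))
    (hdeg : f.natDegree = 4) (hsep : (f.map (Int.castRingHom ℚ)).Separable)
    (hgal : 12 ∣ Nat.card (f.map (Int.castRingHom ℚ)).Gal) : ResidualHyp f hcpt := by
  by_cases h4 : (f.map (Int.castRingHom ℝ)).roots.card = 4
  · exact hEven f hcpt hdeg hsep hgal h4
  · exact hOdd f hcpt hdeg hsep hgal h4

/-- **`closes_ord` — the re-routed deciding theorem** (shape of the current `closes`, one hypothesis more):
`ResidualAutomorphyOdd → ResidualAutomorphyEven → MuOrdinaryFamilyRTOrd → IrregularClassicalityOrd →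
BasicLocusAutomorphy → SectorComplement → Langlands`.  Proof: `SectorComplement` reduces the summit to the
target; fix local Artin data (`nonempty_artinData`); split on the aligned μ-ordinary class of `f`; inside,
13757ᵒʳᵈ (fed the residual branches) then 13758ᵒʳᵈ; outside, the basic branch. [folklore] -/
theorem closes_ord
    (hOdd : Summit.Langlands.Langlands.Theses.PicardMuOrdinary.ResidualAutomorphyOdd)
    (hEven : Summit.Langlands.Langlands.Theses.PicardMuOrdinary.ResidualAutomorphyEven)
    (hRT : MuOrdinaryFamilyRTOrd) (hCl : IrregularClassicalityOrd) (hB : BasicLocusAutomorphy)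
    (hC : Summit.Langlands.Langlands.Theses.PicardMuOrdinary.SectorComplement) :
    _root_.Langlands := by
  refine hC ?_
  intro f hcpt hdeg hsep hgal
  obtain ⟨art⟩ := nonempty_artinData
  by_cases hμ : MuOrdinaryClass art f
  · exact hCl art f hcpt hdeg hsep hgal
      (hRT art f hcpt hdeg hsep hgal hμ (residualHyp_of_branches hOdd hEven f hcpt hdeg hsep hgal))
  · exact hB art f hcpt hdeg hsep hgal hμ (residualHyp_of_branches hOdd hEven f hcpt hdeg hsep hgal)

/-- The re-routed items imply the TARGET directly (the content of `closes_ord` before `SectorComplement`).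
[folklore] -/
theorem picardAutomorphy_of_ord
    (hOdd : Summit.Langlands.Langlands.Theses.PicardMuOrdinary.ResidualAutomorphyOdd)
    (hEven : Summit.Langlands.Langlands.Theses.PicardMuOrdinary.ResidualAutomorphyEven)
    (hRT : MuOrdinaryFamilyRTOrd) (hCl : IrregularClassicalityOrd) (hB : BasicLocusAutomorphy) :
    Summit.Langlands.Langlands.Theses.PicardMuOrdinary.PicardAutomorphy := by
  intro f hcpt hdeg hsep hgal
  obtain ⟨art⟩ := nonempty_artinData
  by_cases hμ : MuOrdinaryClass art f
  · exact hCl art f hcpt hdeg hsep hgal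
      (hRT art f hcpt hdeg hsep hgal hμ (residualHyp_of_branches hOdd hEven f hcpt hdeg hsep hgal))
  · exact hB art f hcpt hdeg hsep hgal hμ (residualHyp_of_branches hOdd hEven f hcpt hdeg hsep hgal)

/-! ## Refutation room -/

/-- 13758ᵒʳᵈ is a weakening of the target (no refutation room). [folklore] -/
theorem irregularClassicalityOrd_of_picardAutomorphy
    (hX : Summit.Langlands.Langlands.Theses.PicardMuOrdinary.PicardAutomorphy) :
    IrregularClassicalityOrd :=
  fun _ f hcpt hdeg hsep hgal _ => hX f hcpt hdeg hsep hgal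

/-- The basic branch is a weakening of the target (no refutation room). [folklore] -/
theorem basicLocusAutomorphy_of_picardAutomorphy
    (hX : Summit.Langlands.Langlands.Theses.PicardMuOrdinary.PicardAutomorphy) :
    BasicLocusAutomorphy :=
  fun _ f hcpt hdeg hsep hgal _ _ => hX f hcpt hdeg hsep hgal

/-- Dominant-ordinary witnesses pass the aligned guard (so the class contains every `f` for which some
twisted Picard witness is ordinary with regular Hodge–Tate weights — and, on paper, the μ-ordinary
limit points of such). [folklore] -/
theorem muOrdinaryGaloisGuard_of_isDominant {art : ArtinData}
    {ρ : FramedGaloisRep (CyclotomicField 3 ℚ) (PadicAlgCl 3) 3}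
    {v : HeightOneSpectrum (𝓞 (CyclotomicField 3 ℚ))}
    (hv : ((3 : ℕ) : 𝓞 (CyclotomicField 3 ℚ)) ∈ v.asIdeal)
    {wt : LabelledWeight (v.adicCompletion (CyclotomicField 3 ℚ)) (PadicAlgCl 3) 3}
    (hwt : wt.IsDominant) (hρ : ρ.IsOrdinaryOfLabelledWeightAt v (art v) wt) :
    MuOrdinaryGaloisGuard art ρ :=
  ⟨v, hv, wt, isAlignedWeight_of_isDominant hwt, hρ⟩

end Summit.Langlands.Langlands.Cruxes.IrregularClassicality.SplitRamifiedPrimeSqrt6.RouteOrd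

end
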